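import Mathlib.LinearAlgebra.BilinearForm.Properties
import Mathlib.Algebra.DirectSum.Module
import Mathlib.LinearAlgebra.Projection
import Mathlib.LinearAlgebra.FiniteDimensional.Defs
import HarnessLib

/-!
# Antisymmetric endomorphisms preserving a paired orthogonal decomposition are sums of block wedges (Zarhin's theorem, step 10b)

Generic linear algebra over a field `K` of characteristic `0`. Let `B` be a nondegenerate symmetric
bilinear form on a finite-dimensional `W`, `W = ⊕ᵢ A i` an internal direct sum and `bar` an
involution of the indices with `B(A i, A j) = 0` unless `j = bar i` (for Zarhin's theorem:
`W = V_ℂ = ⊕_σ T_σ`, the eigenspace blocks of the endomorphism field, `bar σ = σ̄`; Huybrechts,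
*Lectures on K3 Surfaces*, Rem. 3.3.14 (iii), van Geemen, *Real multiplication on K3 surfaces*,
§2.3–2.5). **Theorem** (`ZarhinLie.mem_span_wedge_of_skew`): every `B`-antisymmetric
endomorphism `Z` preserving each `A i` is a `K`-linear combination of the **block wedges**
`x ∧ y = B(y, ·) x - B(x, ·) y` with `x ∈ A i`, `y ∈ A (bar i)`:
`2 Z = ∑ₖ (Z bₖ) ∧ bᵏ` for a basis `(bₖ)` adapted to the decomposition and its `B`-dual basis
`(bᵏ)`, and `bᵏ ∈ A (bar i)` when `bₖ ∈ A i`. This identifies the Lie algebra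
`so_E(T, Ψ) ⊗ ℂ = ⊕ so(T_σ)` (totally real case) resp. `u_E(T, Ψ) ⊗ ℂ` (CM case, the pairs
`T_σ ⊕ T_σ̄`) of Zarhin's theorem (Huybrechts Thm. 3.3.9; Zarhin 1983, Thms. 2.2.1, 2.3.1) with the
span of the block wedges, which the tree shows lie in the complexified Lie algebra of the Hodge
group (`ZarhinHodgeGroupTransport`). No definitions, no named facts.

## References

* D. Huybrechts, *Lectures on K3 Surfaces*, CUP (2016), Thm. 3.3.9, Rem. 3.3.14 (iii).
* B. van Geemen, *Real multiplication on K3 surfaces and Kuga–Satake varieties*, Michigan Math. J.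
  56 (2008), §2.3–2.5.
* Yu. G. Zarhin, *Hodge groups of K3 surfaces*, J. reine angew. Math. 341 (1983), §2.
* N. Bourbaki, *Algèbre*, Ch. IX §? — `so(B) ≅ Λ²` via `u ∧ v ↦ B(v,·)u - B(u,·)v` (folklore).
-/

noncomputable section

namespace Literature.AlgebraicGeometry.Motives

namespace ZarhinLie

universe u v w

variable {K : Type u} [Field K] {W : Type v} [AddCommGroup W] [Module K W]

/-- **`2 Z = ∑ₖ (Z bₖ) ∧ bᵏ` for antisymmetric `Z`**: for a basis `b` of a finite-dimensional
space with nondegenerate symmetric `B`, `B`-dual basis `d` (`B(d k, b l) = δ_{kl}`) and a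
`B`-antisymmetric `Z`, `2 Z w = ∑ₖ (B(d k, w) Z(b k) - B(Z(b k), w) d k)` — the two halves are
`Z(∑ₖ B(d k, w) b k) = Z w` and `∑ₖ B(b k, Z w) d k = Z w`. [folklore] -/
theorem two_smul_apply_eq_sum_wedge [FiniteDimensional K W] {κ : Type w} [Fintype κ]
    [DecidableEq κ] {B : LinearMap.BilinForm K W} (hB : B.IsSymm) (hBn : B.Nondegenerate)
    (b : Module.Basis κ K W) {Z : Module.End K W} (hZ : ∀ x y, B (Z x) y + B x (Z y) = 0) (w : W) :
    (2 : K) • Z w = ∑ k, (B (B.dualBasis hBn b k) w • Z (b k) - B (Z (b k)) w • B.dualBasis hBn b k) := by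
  set d := B.dualBasis hBn b with hd
  -- `B(d k, ·)` is the `k`-th coordinate
  have hcoef : ∀ k w, B (d k) w = b.repr w k := by
    intro k w
    have h : B (d k) = b.coord k := b.ext fun l => by
      rw [hd, LinearMap.BilinForm.apply_dualBasis_left, Module.Basis.coord_apply,
        Module.Basis.repr_self]
      rcases eq_or_ne l k with rfl | h
      · simp
      · simp [h, h.symm]
    rw [h, Module.Basis.coord_apply]
  have hE1 : ∑ k, B (d k) w • b k = w := by
    simp_rw [hcoef]
    exact b.sum_repr w
  have hE2 : ∀ u, ∑ k, B (b k) u • d k = u := by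
    intro u
    have h := d.sum_repr u
    simp_rw [hd, LinearMap.BilinForm.dualBasis_repr_apply] at h
    simp_rw [hB.eq _ u]
    exact h
  rw [Finset.sum_sub_distrib]
  have h1 : ∑ k, B (d k) w • Z (b k) = Z w := by
    simp_rw [← map_smul]
    rw [← map_sum, hE1]
  have h2 : ∑ k, B (Z (b k)) w • d k = -Z w := by
    have h3 : ∀ k, B (Z (b k)) w = -B (b k) (Z w) := fun k =>
      eq_neg_of_add_eq_zero_left (hZ (b k) w)
    simp_rw [h3, neg_smul, Finset.sum_neg_distrib, hE2]
  rw [h1, h2, sub_neg_eq_add, two_smul]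

/-- **The `B`-dual of a basis adapted to a paired orthogonal decomposition is adapted to the
paired decomposition**: if `W = ⊕ A i`, `B(A i, A j) = 0` unless `j = bar i` (`bar` an
involution), `b` is a basis with `b k ∈ A (i k)` and `d` its `B`-dual basis, then `d k ∈ A (bar (i k))`
— the component of `d k` in `A (bar (i k))` already has the pairings `δ_{kl}` with all `b l`.
[folklore] -/
theorem dualBasis_mem [FiniteDimensional K W] {κ : Type w} [Finite κ] [DecidableEq κ]
    {ι : Type*} {B : LinearMap.BilinForm K W} (hBn : B.Nondegenerate)
    {A : ι → Submodule K W} (hind : iSupIndep A) (htop : ⨆ i, A i = ⊤) {bar : ι → ι}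
    (hbar : Function.Involutive bar) (horth : ∀ i j, j ≠ bar i → ∀ x ∈ A i, ∀ y ∈ A j, B x y = 0)
    (b : Module.Basis κ K W) (i : κ → ι) (hb : ∀ k, b k ∈ A (i k)) (k : κ) :
    B.dualBasis hBn b k ∈ A (bar (i k)) := by
  set d := B.dualBasis hBn b with hd
  set i₀ := bar (i k) with hi₀
  have hcompl : IsCompl (A i₀) (⨆ (j : ι) (_ : j ≠ i₀), A j) :=
    ⟨hind i₀, codisjoint_iff.2 (by rw [← iSup_split_single A i₀, htop])⟩
  set u := (A i₀).projection (⨆ (j : ι) (_ : j ≠ i₀), A j) hcompl (d k) with hu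
  have huA : u ∈ A i₀ := Submodule.projection_apply_mem hcompl (d k)
  have hu' : d k - u ∈ ⨆ (j : ι) (_ : j ≠ i₀), A j := by
    rw [hu]
    exact Submodule.sub_projection_mem hcompl (d k)
  -- `B(u, b l) = B(d k, b l)` for every `l`
  have hpair : ∀ l, B u (b l) = B (d k) (b l) := by
    intro l
    by_cases hl : i l = i k
    · -- the complement of `A i₀` is orthogonal to `A (i k)`
      have hzero : ∀ x ∈ (⨆ (j : ι) (_ : j ≠ i₀), A j), B x (b l) = 0 := by
        intro x hx
        induction hx using Submodule.iSup_induction' with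
        | mem j x hx =>
          by_cases hj : j ≠ i₀
          · rw [iSup_pos hj] at hx
            refine horth j (i l) ?_ x hx (b l) (hb l)
            intro h
            apply hj
            rw [hi₀, ← hl, h, hbar j]
          · rw [iSup_neg hj, Submodule.mem_bot] at hx
            rw [hx, map_zero, LinearMap.zero_apply]
        | zero => rw [map_zero, LinearMap.zero_apply]
        | add x y _ _ hx hy => rw [map_add, LinearMap.add_apply, hx, hy, add_zero]
      have h := hzero _ hu'
      rw [map_sub, LinearMap.sub_apply, sub_eq_zero] at h
      exact h.symm
    · have h1 : B u (b l) = 0 := by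
        refine horth i₀ (i l) ?_ u huA (b l) (hb l)
        intro h
        apply hl
        rw [h, hi₀, hbar]
      have h2 : B (d k) (b l) = 0 := by
        rw [hd, LinearMap.BilinForm.apply_dualBasis_left, if_neg]
        intro h
        exact hl (by rw [h])
      rw [h1, h2]
  -- hence `u = d k` by nondegeneracy
  have heq : B (u - d k) = 0 := b.ext fun l => by
    rw [map_sub, LinearMap.sub_apply, hpair l, sub_self, LinearMap.zero_apply]
  have h0 : u - d k = 0 := hBn.1 _ fun y => by rw [heq, LinearMap.zero_apply]
  rw [sub_eq_zero] at h0
  rw [← h0]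
  exact huA

/-- **Antisymmetric endomorphisms preserving a paired orthogonal decomposition are sums of block
wedges.** Let `B` be nondegenerate symmetric on a finite-dimensional `W` over a field of
characteristic `0`, `W = ⊕ᵢ A i` an internal direct sum, `bar` an involution of the indices with
`B(A i, A j) = 0` unless `j = bar i`, and `Z` a `B`-antisymmetric endomorphism preserving every
`A i`. Then `Z` lies in the span of the wedges `x ∧ y = B(y,·)x - B(x,·)y`, `x ∈ A i`,
`y ∈ A (bar i)`: `Z = ½ ∑ₖ (Z bₖ) ∧ bᵏ` for an adapted basis `(bₖ)` with `B`-dual basis `(bᵏ)`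
(`two_smul_apply_eq_sum_wedge`, `dualBasis_mem`). For the blocks `T_σ` of a Hodge structure of K3
type this is `so_E(T,Ψ)_ℂ = ⊕_σ so(T_σ)` / `u_E(T,Ψ)_ℂ` spanned by block wedges (van Geemen
Lemma 2.5; Huybrechts Thm. 3.3.9). [folklore] -/
theorem mem_span_wedge_of_skew [CharZero K] [FiniteDimensional K W] {ι : Type*}
    {B : LinearMap.BilinForm K W} (hB : B.IsSymm) (hBn : B.Nondegenerate)
    {A : ι → Submodule K W} (hind : iSupIndep A) (htop : ⨆ i, A i = ⊤) {bar : ι → ι}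
    (hbar : Function.Involutive bar) (horth : ∀ i j, j ≠ bar i → ∀ x ∈ A i, ∀ y ∈ A j, B x y = 0)
    {Z : Module.End K W} (hZA : ∀ i, ∀ x ∈ A i, Z x ∈ A i)
    (hZ : ∀ x y, B (Z x) y + B x (Z y) = 0) :
    Z ∈ Submodule.span K {T : Module.End K W | ∃ i x y, x ∈ A i ∧ y ∈ A (bar i) ∧
      T = LinearMap.smulRight (B y) x - LinearMap.smulRight (B x) y} := by
  classical
  have hint : DirectSum.IsInternal A :=
    (DirectSum.isInternal_submodule_iff_iSupIndep_and_iSup_eq_top A).2 ⟨hind, htop⟩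
  let v := fun i => Module.finBasis K (A i)
  let b := hint.collectedBasis v
  haveI : Finite (Σ i, Fin (Module.finrank K (A i))) := Module.Finite.finite_basis b
  letI : Fintype (Σ i, Fin (Module.finrank K (A i))) := Fintype.ofFinite _
  have hbmem : ∀ k, b k ∈ A k.1 := fun k => hint.collectedBasis_mem v k
  set d := B.dualBasis hBn b with hd
  have hdmem : ∀ k, d k ∈ A (bar k.1) := fun k =>
    dualBasis_mem hBn hind htop hbar horth b (fun k => k.1) hbmem k
  -- `2 Z = ∑ (Z b k) ∧ d k`
  have h2Z : (2 : K) • Z = ∑ k, (LinearMap.smulRight (B (d k)) (Z (b k)) -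
      LinearMap.smulRight (B (Z (b k))) (d k) : Module.End K W) := by
    refine LinearMap.ext fun w => ?_
    rw [LinearMap.smul_apply, two_smul_apply_eq_sum_wedge hB hBn b hZ w, LinearMap.sum_apply]
    refine Finset.sum_congr rfl fun k _ => ?_
    rw [LinearMap.sub_apply, LinearMap.smulRight_apply, LinearMap.smulRight_apply]
  have hmem : (2 : K) • Z ∈ Submodule.span K {T : Module.End K W | ∃ i x y, x ∈ A i ∧ y ∈ A (bar i) ∧
      T = LinearMap.smulRight (B y) x - LinearMap.smulRight (B x) y} := by
    rw [h2Z]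
    refine Submodule.sum_mem _ fun k _ => Submodule.subset_span ?_
    exact ⟨k.1, Z (b k), d k, hZA _ _ (hbmem k), hdmem k, rfl⟩
  have h : Z = (2 : K)⁻¹ • ((2 : K) • Z) := by
    rw [smul_smul, inv_mul_cancel₀ (two_ne_zero' K), one_smul]
  rw [h]
  exact Submodule.smul_mem _ _ hmem

end ZarhinLie

end Literature.AlgebraicGeometry.Motives

end
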